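import Literature.Probability.LatticeModels.CollarLegModelRainbow
import Literature.Probability.Percolation.FKFreeLoopRepresentation
import Summits.CriticalPhenomena.CardyFormulaZ2.Theorems.CardyBoundaryCoulombGasBoundaryDefectGaussianRStubRealisabilityPart17

/-!
# Stub `stub_realisability` of line `rainbow-monomials-in-excursion-kernels` — Part 18:
# rainbow forcing — a configuration all of whose live turns are consistent is a rainbow
# configuration (crux `BoundaryDefectGaussianR`, stmt-CriticalPhenomena-14132; dictionary D2, layer 3b)

The strand-following argument of the insertion dictionary, for a GENERAL collar leg model
`M : Literature.Probability.LatticeModels.CollarLegModel`, a set `ω ⊆ M.E` of open live edges, a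
height configuration `h` and a finite set `S` of TAGGED END CORNERS `(c, m)` (in the dictionary:
`M = ι.model V`, `S = ι.strandEnds V` of `CollarLegModelRainbow`). Write `σ = nextCorner (M.cfgOf ω)`
for the turning rule of the completed configuration, "cut" for `M.IsCut` (a frozen turn that is not
a consistent tracked turn of the prescribed data), "finish" for a corner whose own turn is a cut
and "start" for the successor corner of a cut turn.

Hypotheses of the abstract theorem `joined_or_joined_of_consistent` (all discharged elsewhere in
layer 2/3 of D2 for the jump collar of an admissible rainbow datum with flat insertion points):

* (H1) every LIVE turn over the piece is consistent for `h` — the summand of `h` in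
  `A(ω) = Σ_h ∏_c turnFactor h (cfgOf ω) c` is nonzero (`prod_turnFactor_eq`);
* (H2) a FROZEN turn that is consistent for the prescribed data is consistent for `h` in `cfgOf ω`
  (the frozen consistency lemma C: the cells a frozen tracked turn compares are prescribed);
* (H3) every end `(c, m) ∈ S` is a tracked corner whose level pair has lower level `m`:
  `min (hv x) (hf f) = m`; (H4) at most two distinct end corners carry the same tag;
* (E1) every tracked finish is an end corner of `S`; (E2) an end corner that is not a finish is a
  start; (E3) two distinct end corners with the same tag are not both finishes.

Proof (`joined_of_not_isCut`): from an end `e` that is not a finish follow `σ`; by (E2) the corner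
before `e` is a cut, so the forward orbit — which stays among the finitely many tracked corners as
long as no cut is met, every non-cut turn being consistent by (H1)/(H2) — meets a cut after at
most `4·#vertexCells` turns (pigeonhole and injectivity of `σ`); at the FIRST cut corner `f ≠ e`
the ordered level pair is that of `e` (Part 17, `hv_hf_iterate_nextCorner_eq`), `f` is a tracked
finish hence an end (E1) with the tag of `e` (H3), hence the other end `e'` with that tag (H4):
`Joined ω e e'`. With (E3) one of two equally tagged ends is not a finish:
`Joined ω e e' ∨ Joined ω e' e`, i.e. the RAINBOW event. Registered sub-goal carried here:
`s14_rainbow_of_valid` (the specialisation `M = ι.model V`, `S = ι.strandEnds V`, conclusion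
`ι.Rainbow V ω`, hypotheses (H1)–(E3) explicit).
-/

namespace Summit.CriticalPhenomena.CardyFormulaZ2.Cruxes.BoundaryDefectGaussianR.RainbowMonomialsInExcursionKernels

open Finset Literature.Probability.LatticeModels Literature.Probability.LatticeModels.CollarLegModel

section Orbit

variable {M : CollarLegModel} {h : ↥M.freeCells → ℤ} {ω : Finset ((ℤ × ℤ) × Bool)}

/-- A tracked corner lies over the piece of the model (`toSite (ofSite x) = x`). [folklore] -/
theorem mem_cornerSet_of_isTracked {c : Site 2 × Fin 4} (hc : M.IsTracked c) :
    c ∈ Literature.Probability.Percolation.cornerSet M.piece := by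
  rw [Literature.Probability.Percolation.mem_cornerSet, piece, mem_image]
  exact ⟨ofSite c.1, hc.1, by funext i; fin_cases i <;> simp [toSite, ofSite]⟩

/-- There are at most `4·#vertexCells` corners over the piece. [folklore] -/
theorem card_cornerSet_piece_le : (Literature.Probability.Percolation.cornerSet M.piece).card ≤ 4 * M.vertexCells.card := by
  rw [Literature.Probability.Percolation.card_cornerSet, piece]
  exact Nat.mul_le_mul_left _ card_image_le

/-- **Frozen targets do not see `ω`**: for `ω ⊆ M.E`, a frozen target edge is open in the completed
configuration of `ω` iff it is a frozen open edge (open in the completed configuration of `∅`). [folklore] -/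
theorem cTgt_mem_cfgOf_iff_of_not_targetsLive (hω : ω ⊆ M.E) {c : Site 2 × Fin 4} (hc : ¬M.TargetsLive c) :
    cTgt c ∈ M.cfgOf ω ↔ cTgt c ∈ M.cfgOf ∅ := by
  rw [cfgOf, cfgOf, Finset.mem_coe, Finset.mem_coe, mem_image, mem_image]
  constructor
  · rintro ⟨e, he, hEq⟩
    rcases mem_union.1 he with he | he
    · exact absurd (mem_image.2 ⟨e, hω he, hEq⟩) hc
    · exact ⟨e, mem_union_right _ he, hEq⟩
  · rintro ⟨e, he, hEq⟩
    rcases mem_union.1 he with he | he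
    · simp at he
    · exact ⟨e, mem_union_right _ he, hEq⟩

/-- Hence the turning rule at a frozen target does not depend on `ω ⊆ M.E`. [folklore] -/
theorem nextCorner_cfgOf_eq_of_not_targetsLive (hω : ω ⊆ M.E) {c : Site 2 × Fin 4} (hc : ¬M.TargetsLive c) :
    nextCorner (M.cfgOf ω) c = nextCorner (M.cfgOf ∅) c := by
  by_cases hb : cTgt c ∈ M.cfgOf ∅
  · rw [nextCorner_of_mem hb, nextCorner_of_mem ((cTgt_mem_cfgOf_iff_of_not_targetsLive hω hc).2 hb)]
  · rw [nextCorner_of_not_mem hb,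
      nextCorner_of_not_mem fun h' => hb ((cTgt_mem_cfgOf_iff_of_not_targetsLive hω hc).1 h')]

/-- **A tracked non-cut turn is consistent** when every live turn over the piece is consistent (H1)
and frozen prescribed-consistent turns are consistent (H2). [folklore] -/
theorem turnConsistent_of_not_isCut
    (H1 : ∀ c ∈ Literature.Probability.Percolation.cornerSet M.piece, M.TargetsLive c → M.TurnConsistent h (M.cfgOf ω) c)
    (H2 : ∀ c, ¬M.TargetsLive c → M.TurnConsistent (fun _ => 0) (M.cfgOf ∅) c → M.TurnConsistent h (M.cfgOf ω) c)
    {c : Site 2 × Fin 4} (hc : M.IsTracked c) (hcut : ¬M.IsCut c) : M.TurnConsistent h (M.cfgOf ω) c := by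
  by_cases hl : M.TargetsLive c
  · exact H1 c (mem_cornerSet_of_isTracked hc) hl
  · refine H2 c hl ?_
    by_contra h'
    exact hcut ⟨hl, h'⟩

/-- **Following the turning rule through non-cut turns keeps the level line tracked**: from a
tracked corner, if none of the first `n` turns is a cut then the first `n + 1` corners are tracked. [folklore] -/
theorem isTracked_iterate
    (H1 : ∀ c ∈ Literature.Probability.Percolation.cornerSet M.piece, M.TargetsLive c → M.TurnConsistent h (M.cfgOf ω) c)
    (H2 : ∀ c, ¬M.TargetsLive c → M.TurnConsistent (fun _ => 0) (M.cfgOf ∅) c → M.TurnConsistent h (M.cfgOf ω) c)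
    {c₀ : Site 2 × Fin 4} (h₀ : M.IsTracked c₀) (n : ℕ)
    (hn : ∀ m < n, ¬M.IsCut ((nextCorner (M.cfgOf ω))^[m] c₀)) :
    ∀ m ≤ n, M.IsTracked ((nextCorner (M.cfgOf ω))^[m] c₀) := by
  intro m
  induction m with
  | zero => intro; exact h₀
  | succ m ih =>
    intro hm
    have htc := turnConsistent_of_not_isCut H1 H2 (ih (Nat.le_of_succ_le hm)) (hn m hm)
    rw [Function.iterate_succ_apply']
    exact htc.2.1

/-- **Pigeonhole**: more than `4·#vertexCells` consecutive tracked corners of an orbit repeat. [folklore] -/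
theorem exists_lt_iterate_eq {c₀ : Site 2 × Fin 4} {K : ℕ}
    (htr : ∀ m ≤ K, M.IsTracked ((nextCorner (M.cfgOf ω))^[m] c₀)) (hK : 4 * M.vertexCells.card ≤ K) :
    ∃ i j, i < j ∧ j ≤ K ∧ (nextCorner (M.cfgOf ω))^[i] c₀ = (nextCorner (M.cfgOf ω))^[j] c₀ := by
  have hmaps : Set.MapsTo (fun m => (nextCorner (M.cfgOf ω))^[m] c₀) ↑(range (K + 1))
      ↑(Literature.Probability.Percolation.cornerSet M.piece) := fun m hm =>
    mem_cornerSet_of_isTracked (htr m (Nat.lt_succ_iff.1 (mem_range.1 hm)))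
  have hcard : (Literature.Probability.Percolation.cornerSet M.piece).card < (range (K + 1)).card := by
    rw [card_range]
    exact Nat.lt_succ_of_le (card_cornerSet_piece_le.trans hK)
  obtain ⟨i, hi, j, hj, hne, hEq⟩ := exists_ne_map_eq_of_card_lt_of_maps_to hcard hmaps
  have hi' : i ≤ K := Nat.lt_succ_iff.1 (mem_range.1 hi)
  have hj' : j ≤ K := Nat.lt_succ_iff.1 (mem_range.1 hj)
  rcases lt_or_gt_of_ne hne with hlt | hlt
  · exact ⟨i, j, hlt, hj', hEq⟩
  · exact ⟨j, i, hlt, hi', hEq.symm⟩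

/-- A repetition `σ^i c₀ = σ^j c₀`, `i < j`, makes the orbit periodic: `σ^{j-i} c₀ = c₀`
(injectivity of the turning rule). [folklore] -/
theorem iterate_sub_eq_self {c₀ : Site 2 × Fin 4} {i j : ℕ} (hij : i < j)
    (hEq : (nextCorner (M.cfgOf ω))^[i] c₀ = (nextCorner (M.cfgOf ω))^[j] c₀) :
    (nextCorner (M.cfgOf ω))^[j - i] c₀ = c₀ := by
  apply (nextCorner_injective (β := M.cfgOf ω)).iterate i
  rw [← Function.iterate_add_apply, Nat.add_sub_cancel' hij.le]
  exact hEq.symm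

/-- On a periodic orbit `σ^q c₀ = c₀`, `q ≥ 1`, the corner before `c₀` is `σ^{q-1} c₀`. [folklore] -/
theorem iterate_pred_eq {c₀ p : Site 2 × Fin 4} {q : ℕ} (hq : 1 ≤ q)
    (hper : (nextCorner (M.cfgOf ω))^[q] c₀ = c₀) (hp : nextCorner (M.cfgOf ω) p = c₀) :
    (nextCorner (M.cfgOf ω))^[q - 1] c₀ = p := by
  apply nextCorner_injective (β := M.cfgOf ω)
  rw [hp, ← Function.iterate_succ_apply' (f := nextCorner (M.cfgOf ω)), Nat.succ_eq_add_one,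
    Nat.sub_add_cancel hq, hper]

end Orbit

section Forcing

variable {M : CollarLegModel} {h : ↥M.freeCells → ℤ} {ω : Finset ((ℤ × ℤ) × Bool)}
  {S : Finset ((Site 2 × Fin 4) × ℤ)}

/-- **The strand from a start reaches the other end with the same tag.** Under (H1)–(H4), (E1),
(E2) (module docstring): if `e, e' ∈ S` are distinct end corners with the same tag and `e` is not a
finish, then following the turning rule of `cfgOf ω` from `e` one reaches `e'` before any cut:
`M.Joined ω e e'`. [cite: BaxterKellandWu1976, §3–§4] -/
theorem joined_of_not_isCut (hω : ω ⊆ M.E)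
    (H1 : ∀ c ∈ Literature.Probability.Percolation.cornerSet M.piece, M.TargetsLive c → M.TurnConsistent h (M.cfgOf ω) c)
    (H2 : ∀ c, ¬M.TargetsLive c → M.TurnConsistent (fun _ => 0) (M.cfgOf ∅) c → M.TurnConsistent h (M.cfgOf ω) c)
    (H3 : ∀ e ∈ S, M.IsTracked e.1 ∧ min (M.hv h (ofSite e.1.1)) (M.hf h (ofSite (cFace e.1))) = e.2)
    (H4 : ∀ e₁ ∈ S, ∀ e₂ ∈ S, ∀ e₃ ∈ S, e₁.2 = e₂.2 → e₁.2 = e₃.2 → e₁.1 = e₂.1 ∨ e₁.1 = e₃.1 ∨ e₂.1 = e₃.1)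
    (E1 : ∀ c, M.IsTracked c → M.IsCut c → ∃ m : ℤ, (c, m) ∈ S)
    (E2 : ∀ e ∈ S, ¬M.IsCut e.1 → ∃ c, M.IsCut c ∧ nextCorner (M.cfgOf ∅) c = e.1)
    {e e' : (Site 2 × Fin 4) × ℤ} (he : e ∈ S) (he' : e' ∈ S) (htag : e.2 = e'.2) (hne : e.1 ≠ e'.1)
    (hcut : ¬M.IsCut e.1) : M.Joined ω e.1 e'.1 := by
  classical
  -- the corner before `e` is a cut `p`, and `σ p = e` also in `cfgOf ω`
  obtain ⟨p, hp, hpe⟩ := E2 e he hcut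
  have hpe' : nextCorner (M.cfgOf ω) p = e.1 := by
    rw [nextCorner_cfgOf_eq_of_not_targetsLive hω hp.1, hpe]
  have htr0 : M.IsTracked e.1 := (H3 e he).1
  -- Step 1: some corner of the forward orbit, at most `4·#vertexCells` turns away, is a cut
  have hex : ∃ n, n ≤ 4 * M.vertexCells.card ∧ M.IsCut ((nextCorner (M.cfgOf ω))^[n] e.1) := by
    by_contra hno
    push Not at hno
    have htr : ∀ m ≤ 4 * M.vertexCells.card + 1, M.IsTracked ((nextCorner (M.cfgOf ω))^[m] e.1) :=
      isTracked_iterate H1 H2 htr0 _ fun m hm => hno m (Nat.lt_succ_iff.1 hm)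
    obtain ⟨i, j, hij, hj, hEq⟩ := exists_lt_iterate_eq htr (Nat.le_succ _)
    have hper := iterate_sub_eq_self hij hEq
    have hpred := iterate_pred_eq (Nat.le_sub_of_add_le' hij) hper hpe'
    refine hno (j - i - 1) ?_ ?_
    · omega
    · rw [hpred]; exact hp
  -- Step 2: the first such corner
  set n := Nat.find hex with hn
  have hnN : n ≤ 4 * M.vertexCells.card := (Nat.find_spec hex).1
  have hncut : M.IsCut ((nextCorner (M.cfgOf ω))^[n] e.1) := (Nat.find_spec hex).2
  have hbefore : ∀ m < n, ¬M.IsCut ((nextCorner (M.cfgOf ω))^[m] e.1) := fun m hm hc =>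
    absurd (Nat.find_min' hex ⟨(le_of_lt hm).trans hnN, hc⟩) (not_le.2 hm)
  -- it is not `e` itself: `e` is not a cut, and a return to `e` passes through the cut `p` first
  have hne1 : (nextCorner (M.cfgOf ω))^[n] e.1 ≠ e.1 := by
    intro hEq
    rcases Nat.eq_zero_or_pos n with h0 | hpos
    · rw [h0] at hncut
      exact hcut hncut
    · have hpred := iterate_pred_eq hpos hEq hpe'
      exact hbefore (n - 1) (Nat.sub_lt hpos Nat.one_pos) (by rw [hpred]; exact hp)
  -- the corners up to it are tracked and the turns before it consistent
  have htr : ∀ m ≤ n, M.IsTracked ((nextCorner (M.cfgOf ω))^[m] e.1) := isTracked_iterate H1 H2 htr0 n hbefore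
  have htc : ∀ m < n, M.TurnConsistent h (M.cfgOf ω) ((nextCorner (M.cfgOf ω))^[m] e.1) := fun m hm =>
    turnConsistent_of_not_isCut H1 H2 (htr m hm.le) (hbefore m hm)
  -- so the level pair at the cut corner is that of `e`
  have hpair := hv_hf_iterate_nextCorner_eq M h (M.cfgOf ω) n e.1 htc
  -- the cut corner is a registered end, with the tag of `e`
  obtain ⟨m', hm'⟩ := E1 _ (htr n le_rfl) hncut
  have htag' : m' = e.2 := by
    have h3 := (H3 _ hm').2
    have h3e := (H3 e he).2
    simp only at h3
    rw [hpair.1, hpair.2, h3e] at h3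
    exact h3.symm
  -- hence it is `e'`
  rcases H4 e he e' he' _ hm' htag (by rw [htag']) with h1 | h2 | h3
  · exact absurd h1 hne
  · exact absurd h2.symm hne1
  · exact ⟨n, hnN, h3.symm, hbefore⟩

/-- **Rainbow forcing, abstract form.** Under (H1)–(H4), (E1)–(E3) of the module docstring, every
two distinct end corners of `S` with the same tag are joined by a strand of the completed
configuration of `ω`, in one of the two directions. [cite: BaxterKellandWu1976, §3–§4] -/
theorem joined_or_joined_of_consistent (hω : ω ⊆ M.E)
    (H1 : ∀ c ∈ Literature.Probability.Percolation.cornerSet M.piece, M.TargetsLive c → M.TurnConsistent h (M.cfgOf ω) c)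
    (H2 : ∀ c, ¬M.TargetsLive c → M.TurnConsistent (fun _ => 0) (M.cfgOf ∅) c → M.TurnConsistent h (M.cfgOf ω) c)
    (H3 : ∀ e ∈ S, M.IsTracked e.1 ∧ min (M.hv h (ofSite e.1.1)) (M.hf h (ofSite (cFace e.1))) = e.2)
    (H4 : ∀ e₁ ∈ S, ∀ e₂ ∈ S, ∀ e₃ ∈ S, e₁.2 = e₂.2 → e₁.2 = e₃.2 → e₁.1 = e₂.1 ∨ e₁.1 = e₃.1 ∨ e₂.1 = e₃.1)
    (E1 : ∀ c, M.IsTracked c → M.IsCut c → ∃ m : ℤ, (c, m) ∈ S)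
    (E2 : ∀ e ∈ S, ¬M.IsCut e.1 → ∃ c, M.IsCut c ∧ nextCorner (M.cfgOf ∅) c = e.1)
    (E3 : ∀ e ∈ S, ∀ e' ∈ S, e.2 = e'.2 → e.1 ≠ e'.1 → ¬(M.IsCut e.1 ∧ M.IsCut e'.1)) :
    ∀ e ∈ S, ∀ e' ∈ S, e.2 = e'.2 → e.1 ≠ e'.1 → M.Joined ω e.1 e'.1 ∨ M.Joined ω e'.1 e.1 := by
  intro e he e' he' htag hne
  by_cases hc : M.IsCut e.1
  · have hc' : ¬M.IsCut e'.1 := fun h' => E3 e he e' he' htag hne ⟨hc, h'⟩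
    exact Or.inr (joined_of_not_isCut hω H1 H2 H3 H4 E1 E2 he' he htag.symm hne.symm hc')
  · exact Or.inl (joined_of_not_isCut hω H1 H2 H3 H4 E1 E2 he he' htag hne hc)

end Forcing

/-! ### Glue to the registered strand-end lemmas `s14_strandEnds_pairs` / `s14_strandEnds_tags` -/

section Glue

variable {S : Finset ((Site 2 × Fin 4) × ℤ)}

/-- (H4) from the tag count: if every tag class of `S` has at most two elements, then at most two
distinct end corners carry the same tag. [folklore] -/
theorem atMostTwo_of_card_filter_le_two
    (hcard : ∀ e ∈ S, (S.filter (fun e' => e'.2 = e.2)).card ≤ 2) :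
    ∀ e₁ ∈ S, ∀ e₂ ∈ S, ∀ e₃ ∈ S, e₁.2 = e₂.2 → e₁.2 = e₃.2 → e₁.1 = e₂.1 ∨ e₁.1 = e₃.1 ∨ e₂.1 = e₃.1 := by
  intro e₁ h₁ e₂ h₂ e₃ h₃ h12 h13
  by_contra hne
  push Not at hne
  obtain ⟨n12, n13, n23⟩ := hne
  have hsub : ({e₁, e₂, e₃} : Finset _) ⊆ S.filter (fun e' => e'.2 = e₁.2) := by
    intro e he
    simp only [mem_insert, mem_singleton] at he
    rw [mem_filter]
    rcases he with rfl | rfl | rfl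
    · exact ⟨h₁, rfl⟩
    · exact ⟨h₂, h12.symm⟩
    · exact ⟨h₃, h13.symm⟩
  have h3 : ({e₁, e₂, e₃} : Finset _).card = 3 :=
    card_eq_three.2 ⟨e₁, e₂, e₃, fun h => n12 (by rw [h]), fun h => n13 (by rw [h]), fun h => n23 (by rw [h]), rfl⟩
  have := card_le_card hsub
  rw [h3] at this
  exact absurd (this.trans (hcard e₁ h₁)) (by norm_num)

/-- (H4) for the strand ends of a leg insertion, from the conclusion of `s14_strandEnds_tags`
(tags in `[-L, -1]`, each tag class of cardinality two). [folklore] -/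
theorem atMostTwo_of_tags {L : ℤ}
    (hrange : ∀ e ∈ S, -L ≤ e.2 ∧ e.2 ≤ -1)
    (htwo : ∀ m : ℤ, -L ≤ m → m ≤ -1 → (S.filter (fun e => e.2 = m)).card = 2) :
    ∀ e₁ ∈ S, ∀ e₂ ∈ S, ∀ e₃ ∈ S, e₁.2 = e₂.2 → e₁.2 = e₃.2 → e₁.1 = e₂.1 ∨ e₁.1 = e₃.1 ∨ e₂.1 = e₃.1 :=
  atMostTwo_of_card_filter_le_two fun e he => (htwo e.2 (hrange e he).1 (hrange e he).2).le

variable (ι : LegInsertionData) (V : Finset (ℤ × ℤ))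

/-- **Rainbow forcing for the jump collar of a leg insertion**, with the strand-end inputs in the
shape of the registered lemmas: `hpairs` = conclusion of `s14_strandEnds_pairs`, `htags` =
conclusion of `s14_strandEnds_tags` (both available for admissible data with flat insertion
points); the remaining hypotheses are (H1) all live turns consistent, (H2) the frozen consistency
transfer, and (E1)–(E3) the identification of the registered ends with the strand ends adjacent to
cuts. Conclusion: `ι.Rainbow V ω`. [cite: BaxterKellandWu1976, §3–§4] -/
theorem rainbow_of_strandEnds {ω : Finset ((ℤ × ℤ) × Bool)} {h : ↥(ι.model V).freeCells → ℤ}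
    (hω : ω ⊆ (ι.model V).E)
    (H1 : ∀ c ∈ Literature.Probability.Percolation.cornerSet (ι.model V).piece,
      (ι.model V).TargetsLive c → (ι.model V).TurnConsistent h ((ι.model V).cfgOf ω) c)
    (H2 : ∀ c, ¬(ι.model V).TargetsLive c → (ι.model V).TurnConsistent (fun _ => 0) ((ι.model V).cfgOf ∅) c →
      (ι.model V).TurnConsistent h ((ι.model V).cfgOf ω) c)
    (hpairs : ∀ e ∈ ι.strandEnds V, (ι.model V).IsTracked e.1 ∧ ∀ h : ↥(ι.model V).freeCells → ℤ,
      (ι.model V).IsValid h →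
        min ((ι.model V).hv h (ofSite e.1.1)) ((ι.model V).hf h (ofSite (cFace e.1))) = e.2 ∧
          max ((ι.model V).hv h (ofSite e.1.1)) ((ι.model V).hf h (ofSite (cFace e.1))) = e.2 + 1)
    (htags : (∀ e ∈ ι.strandEnds V, -(ι.sinkLegs : ℤ) ≤ e.2 ∧ e.2 ≤ -1) ∧
      (∀ m : ℤ, -(ι.sinkLegs : ℤ) ≤ m → m ≤ -1 → ((ι.strandEnds V).filter (fun e => e.2 = m)).card = 2) ∧
      (∀ e ∈ ι.strandEnds V, ∀ e' ∈ ι.strandEnds V, e.1 = e'.1 → e = e') ∧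
      (ι.strandEnds V).card = 2 * ι.sinkLegs)
    (E1 : ∀ c, (ι.model V).IsTracked c → (ι.model V).IsCut c → ∃ m : ℤ, (c, m) ∈ ι.strandEnds V)
    (E2 : ∀ e ∈ ι.strandEnds V, ¬(ι.model V).IsCut e.1 →
      ∃ c, (ι.model V).IsCut c ∧ nextCorner ((ι.model V).cfgOf ∅) c = e.1)
    (E3 : ∀ e ∈ ι.strandEnds V, ∀ e' ∈ ι.strandEnds V, e.2 = e'.2 → e.1 ≠ e'.1 →
      ¬((ι.model V).IsCut e.1 ∧ (ι.model V).IsCut e'.1))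
    (hvalid : (ι.model V).IsValid h) : ι.Rainbow V ω :=
  joined_or_joined_of_consistent hω H1 H2 (fun e he => ⟨(hpairs e he).1, ((hpairs e he).2 h hvalid).1⟩)
    (atMostTwo_of_tags htags.1 htags.2.1) E1 E2 E3

end Glue

/-- Registered sub-goal `s14_rainbow_of_valid` of `stub_realisability` (D2, layer 3b): for a leg
insertion datum `ι` on `V` with jump collar `M = ι.model V`, a set `ω ⊆ M.E` of open live edges and
a height configuration `h` ALL OF WHOSE LIVE TURNS ARE CONSISTENT in `cfgOf ω` (H1: the summand of
`h` in `A(ω)` is nonzero), the configuration `ω` is a RAINBOW configuration (`ι.Rainbow V ω`) —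
given, as explicit hypotheses, the frozen consistency transfer (H2, lemma C of layer 2), the level
pairs and tag multiplicities of the strand ends (H3, H4: `s14_strandEnds_pairs/_tags`) and the
identification of the strand ends of the model with the registered ends (E1: every tracked cut
corner is registered; E2: a registered end that is not a cut follows a cut; E3: two registered
ends with one tag are not both cuts). One-line form of `joined_or_joined_of_consistent`. [cite: BaxterKellandWu1976, §3–§4] -/
theorem s14_rainbow_of_valid : ∀ (ι : Literature.Probability.LatticeModels.CollarLegModel.LegInsertionData) (V : Finset (ℤ × ℤ)) (ω : Finset ((ℤ × ℤ) × Bool)) (h : ↥(Literature.Probability.LatticeModels.CollarLegModel.LegInsertionData.model ι V).freeCells → ℤ), ω ⊆ (Literature.Probability.LatticeModels.CollarLegModel.LegInsertionData.model ι V).E → (∀ c ∈ Literature.Probability.Percolation.cornerSet (Literature.Probability.LatticeModels.CollarLegModel.LegInsertionData.model ι V).piece, (Literature.Probability.LatticeModels.CollarLegModel.LegInsertionData.model ι V).TargetsLive c → (Literature.Probability.LatticeModels.CollarLegModel.LegInsertionData.model ι V).TurnConsistent h ((Literature.Probability.LatticeModels.CollarLegModel.LegInsertionData.model ι V).cfgOf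 ω) c) → (∀ c, ¬(Literature.Probability.LatticeModels.CollarLegModel.LegInsertionData.model ι V).TargetsLive c → (Literature.Probability.LatticeModels.CollarLegModel.LegInsertionData.model ι V).TurnConsistent (fun _ => 0) ((Literature.Probability.LatticeModels.CollarLegModel.LegInsertionData.model ι V).cfgOf ∅) c → (Literature.Probability.LatticeModels.CollarLegModel.LegInsertionData.model ι V).TurnConsistent h ((Literature.Probability.LatticeModels.CollarLegModel.LegInsertionData.model ι V).cfgOf ω) c) → (∀ e ∈ Literature.Probability.LatticeModels.CollarLegModel.LegInsertionData.strandEnds ι V, (Literature.Probability.LatticeModels.CollarLegModel.LegInsertionData.model ι V).IsTracked e.1 ∧ min ((Literature.Probability.LatticeModels.CollarLegModel.LegInsertionData.model ι V).hv h (Literature.Probability.LatticeModels.CollarLegModel.ofSite e.1.1)) ((Literature.Probability.LatticeModels.CollarLegModel.LegInsertionData.model ι V).hf h (Literature.Probability.LatticeModels.CollarLegModel.ofSite (Literature.Probability.LatticeModels.cFace e.1))) = e.2) → (∀ e₁ ∈ Literature.Probability.LatticeModels.CollarLegModel.LegInsertionData.strandEnds ι V, ∀ e₂ ∈ Literature.Probability.LatticeModels.CollarLegModel.LegInsertionData.strandEnds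 ι V, ∀ e₃ ∈ Literature.Probability.LatticeModels.CollarLegModel.LegInsertionData.strandEnds ι V, e₁.2 = e₂.2 → e₁.2 = e₃.2 → e₁.1 = e₂.1 ∨ e₁.1 = e₃.1 ∨ e₂.1 = e₃.1) → (∀ c, (Literature.Probability.LatticeModels.CollarLegModel.LegInsertionData.model ι V).IsTracked c → (Literature.Probability.LatticeModels.CollarLegModel.LegInsertionData.model ι V).IsCut c → ∃ m : ℤ, (c, m) ∈ Literature.Probability.LatticeModels.CollarLegModel.LegInsertionData.strandEnds ι V) → (∀ e ∈ Literature.Probability.LatticeModels.CollarLegModel.LegInsertionData.strandEnds ι V, ¬(Literature.Probability.LatticeModels.CollarLegModel.LegInsertionData.model ι V).IsCut e.1 → ∃ c, (Literature.Probability.LatticeModels.CollarLegModel.LegInsertionData.model ι V).IsCut c ∧ Literature.Probability.LatticeModels.nextCorner ((Literature.Probability.LatticeModels.CollarLegModel.LegInsertionData.model ι V).cfgOf ∅) c = e.1) → (∀ e ∈ Literature.Probability.LatticeModels.CollarLegModel.LegInsertionData.strandEnds ι V, ∀ e' ∈ Literature.Probability.LatticeModels.CollarLegModel.LegInsertionData.strandEnds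 ι V, e.2 = e'.2 → e.1 ≠ e'.1 → ¬((Literature.Probability.LatticeModels.CollarLegModel.LegInsertionData.model ι V).IsCut e.1 ∧ (Literature.Probability.LatticeModels.CollarLegModel.LegInsertionData.model ι V).IsCut e'.1)) → Literature.Probability.LatticeModels.CollarLegModel.LegInsertionData.Rainbow ι V ω :=
  fun _ _ _ _ hω H1 H2 H3 H4 E1 E2 E3 => joined_or_joined_of_consistent hω H1 H2 H3 H4 E1 E2 E3

end Summit.CriticalPhenomena.CardyFormulaZ2.Cruxes.BoundaryDefectGaussianR.RainbowMonomialsInExcursionKernels
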